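import Mathlib
import Summits.ValiantsHypothesis.ValiantsHypothesis.Theorems.GrenetZeonTwoDimCoefficientsDualUnipotentLayeredHessianRate

/-!
# Crux `GrenetZeon.TwoDimCoefficients` (stmt-ValiantsHypothesis-8062) / rung `DualUnipotentThreeHalves`
# (stmt-ValiantsHypothesis-24318): (H) `HessianRate` ON THE LAYERED FAMILY — ASSEMBLY (`C = 4`)

Conjecture (H) (the hypothesis `hC` of ✓ `threeHalves_of_hessianRate`, the plan of record for the 3/2 rung
24318) says: a unipotent-dual / power-trace representation of width `m` and degree `d` has
`rank Hess_p ≤ C·m²/d` at every point.  Before this seat it was tight for the equal-width trace chain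
(✓ `rank_hessMat`), false without the trace constraints (✓ `not_hessianRankBound_unipotentTrace`) and otherwise
only numerically supported.  This file assembles the kernel proof of (H), `C = 4`, on the whole LAYERED family
(every pencil that is block-superdiagonal for a level function with `d+1` levels, arbitrary widths, arbitrary
point, arbitrary corner weight), in ROW-BLOCK / coordinate form: with `D ℓ = diag[lvl = ℓ]`, `P = Σ_{k≤d} A^k`,
`Q = P·E·P`, the Hessian functional of the pencil direction `U'` is `U ↦ tr(U·(P·U'·Q + Q·U'·P))` (note
`HESSIAN-RATE-LAYERED.md` (★), evidence on both items), whose coordinates on the levelled directions `U` are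
the entries of `Σ_{i<d} D_{i+1}·(P·U'·Q + Q·U'·P)·D_i`; so the rank of the Hessian restricted to the pencil is at
most the dimension bounded here.

* `finrank_finset_sup_le_sum`, `sum_card_level_pairs_le` — bookkeeping.
* ★ `finrank_span_layeredHessianImage_le` — for EVERY level `ℓ⋆ ≤ d` of width `t`:
  `dim span{Σ_i D_{i+1}(PU'Q + QU'P)D_i : U' levelled} ≤ 2·t·Σ_{i<d}(#{lvl = i+1} + #{lvl = i})`
  (decompose `U' = Σ_j D_jU'D_{j+1}` ✓ `levelled_eq_sum_proj_mul_mul_proj`, land in the two row-block families,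
  ✓ `finrank_span_upperRowBlock_le` / ✓ `finrank_span_lowerRowBlock_le`, sum over `i`).
* ★ `finrank_span_layeredHessianImage_le'` — hence `≤ 4·t·#ι`; with the thinnest level (`t·(d+1) ≤ #ι = m`)
  this is `rank Hess ≤ 4m²/(d+1)`: **(H) with `C = 4` on the layered family.**

What is NOT here (honest): the identification of this coordinate form with `hess0` of the `MvPolynomial`
`tr(adj(1−N)·B)` at a point (note (★), ≈300 l in the style of ✓ `…TraceChainHessian`); the wild case of (H);
any stub.  Layered ⊂ triangularisable, where the 3/2 conclusion is already known by flats
(✓ `sq_le_of_trace_pow_mul_strictUpper`): this file proves NO rung, stub or crux; `DualUnipotentBound`, 24318,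
(c), `VP ≠ VNP` are NOT proved.  Def-free.
-/

-- single-conjunct layout `Summits/ValiantsHypothesis/ValiantsHypothesis`: the duplicated namespace
-- component is mandated by the tree.
set_option linter.dupNamespace false

noncomputable section

namespace Summit.ValiantsHypothesis.ValiantsHypothesis.Cruxes.TwoDimCoefficients.DimTwoCases

open Matrix

variable {K : Type*} [Field K] {ι : Type*} [Fintype ι] [DecidableEq ι]

/-! ### Assembly: (H) on the layered family, `C = 4` -/

omit [Fintype ι] [DecidableEq ι] in
/-- `dim (sup_{i ∈ s} F i) ≤ Σ_{i ∈ s} dim (F i)` in a finite-dimensional space. [folklore] -/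
theorem finrank_finset_sup_le_sum {α V : Type*} [AddCommGroup V] [Module K V] [Module.Finite K V]
    (s : Finset α) (F : α → Submodule K V) :
    Module.finrank K ↥(s.sup F) ≤ ∑ i ∈ s, Module.finrank K (F i) := by
  classical
  induction s using Finset.induction_on with
  | empty => simp
  | insert a s ha ih =>
      rw [Finset.sup_insert, Finset.sum_insert ha]
      have h := Submodule.finrank_sup_add_finrank_inf_eq (F a) (s.sup F)
      have : Module.finrank K ↥(F a ⊔ s.sup F) ≤ Module.finrank K (F a) + Module.finrank K ↥(s.sup F) := by
        omega
      exact this.trans (Nat.add_le_add_left ih _)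

omit [DecidableEq ι] in
/-- The level widths below the top sum to at most the total size, twice:
`Σ_{i<d} (#{lvl = i+1} + #{lvl = i}) ≤ 2·#ι`. [folklore] -/
theorem sum_card_level_pairs_le (lvl : ι → ℕ) (d : ℕ) :
    ∑ i ∈ Finset.range d, (Fintype.card {a // lvl a = i + 1} + Fintype.card {a // lvl a = i}) ≤
      2 * Fintype.card ι := by
  classical
  have hfib : ∀ s : Finset ℕ, ∑ i ∈ s, Fintype.card {a // lvl a = i} ≤ Fintype.card ι := by
    intro s
    have hdisj : ∀ x ∈ s, ∀ y ∈ s, x ≠ y →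
        Disjoint (Finset.univ.filter fun a : ι => lvl a = x) (Finset.univ.filter fun a : ι => lvl a = y) := by
      intro x _ y _ hxy
      exact Finset.disjoint_filter.mpr fun a _ hx hy => hxy (hx.symm.trans hy)
    calc ∑ i ∈ s, Fintype.card {a // lvl a = i}
        = ∑ i ∈ s, (Finset.univ.filter fun a : ι => lvl a = i).card :=
          Finset.sum_congr rfl fun i _ => Fintype.card_subtype _
      _ = (s.biUnion fun i => Finset.univ.filter fun a : ι => lvl a = i).card :=
          (Finset.card_biUnion hdisj).symm
      _ ≤ Fintype.card ι := Finset.card_le_univ _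
  rw [Finset.sum_add_distrib, two_mul]
  refine Nat.add_le_add ?_ (hfib _)
  calc ∑ i ∈ Finset.range d, Fintype.card {a // lvl a = i + 1}
      = ∑ i ∈ (Finset.range d).map ⟨Nat.succ, Nat.succ_injective⟩, Fintype.card {a // lvl a = i} := by
        rw [Finset.sum_map]; rfl
    _ ≤ Fintype.card ι := hfib _

/-- **(H) ON THE LAYERED FAMILY, row-block form, assembled.**  For a levelled point `A` (levels `≤ d`), a
corner weight `E`, `P = Σ_{k≤d} A^k`, `Q = P·E·P`, and EVERY level `ℓ⋆ ≤ d` of width `t = #{lvl = ℓ⋆}`: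
the matrices `Σ_{i<d} D_{i+1}·(P·U'·Q + Q·U'·P)·D_i`, `U'` ranging over the LEVELLED directions (this is the
coordinate form of the Hessian functional `U ↦ tr(U·(P U' Q + Q U' P))` on the pencil, note (★)), span a
space of dimension `≤ 2·t·Σ_{i<d}(#{lvl = i+1} + #{lvl = i}) ≤ 4·t·#ι`.  With `ℓ⋆` the thinnest level
(`t ≤ #ι/(d+1)`) this is `rank Hess ≤ 4m²/(d+1)`: conjecture (H) with `C = 4` on every pencil that is
block-superdiagonal for a level function with `d+1` levels (note `HESSIAN-RATE-LAYERED.md` §1–3, §8).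
[folklore] -/
theorem finrank_span_layeredHessianImage_le (lvl : ι → ℕ) (D : ℕ → Matrix ι ι K)
    (hD : ∀ ℓ, D ℓ = Matrix.diagonal fun a => if lvl a = ℓ then (1 : K) else 0)
    {d : ℕ} (hlvl : ∀ a, lvl a ≤ d) (A E : Matrix ι ι K)
    (hA : ∀ a b, A a b ≠ 0 → lvl b = lvl a + 1) (hE : ∀ a b, E a b ≠ 0 → lvl a = d ∧ lvl b = 0)
    {ℓs : ℕ} (hℓs : ℓs ≤ d) :
    Module.finrank K (Submodule.span K {Y : Matrix ι ι K | ∃ U' : Matrix ι ι K,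
        (∀ a b, U' a b ≠ 0 → lvl b = lvl a + 1) ∧
        Y = ∑ i ∈ Finset.range d, D (i + 1) *
              ((∑ k ∈ Finset.range (d + 1), A ^ k) * U' *
                  ((∑ k ∈ Finset.range (d + 1), A ^ k) * E * (∑ k ∈ Finset.range (d + 1), A ^ k)) +
               ((∑ k ∈ Finset.range (d + 1), A ^ k) * E * (∑ k ∈ Finset.range (d + 1), A ^ k)) * U' *
                  (∑ k ∈ Finset.range (d + 1), A ^ k)) * D i}) ≤
      2 * Fintype.card {a // lvl a = ℓs} *
        ∑ i ∈ Finset.range d, (Fintype.card {a // lvl a = i + 1} + Fintype.card {a // lvl a = i}) := by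
  classical
  set P : Matrix ι ι K := ∑ k ∈ Finset.range (d + 1), A ^ k with hP
  set Q : Matrix ι ι K := P * E * P with hQ
  -- the two families of row blocks
  let F1 : ℕ → Submodule K (Matrix ι ι K) := fun i => Submodule.span K {Z : Matrix ι ι K |
      ∃ j : Fin d, ∃ X' : Matrix ι ι K, Z = (D (i + 1) * P * D j) * X' * (D (j + 1) * Q * D i)}
  let F2 : ℕ → Submodule K (Matrix ι ι K) := fun i => Submodule.span K {Z : Matrix ι ι K |
      ∃ j : Fin d, ∃ X' : Matrix ι ι K, Z = (D (i + 1) * Q * D j) * X' * (D (j + 1) * P * D i)}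
  have hF1 : ∀ i ∈ Finset.range d, Module.finrank K (F1 i) ≤
      Fintype.card {a // lvl a = ℓs} * (Fintype.card {a // lvl a = i + 1} + Fintype.card {a // lvl a = i}) :=
    fun i hi => finrank_span_upperRowBlock_le lvl D hD A E hA hE (by simpa using hi) hℓs
  have hF2 : ∀ i ∈ Finset.range d, Module.finrank K (F2 i) ≤
      Fintype.card {a // lvl a = ℓs} * (Fintype.card {a // lvl a = i + 1} + Fintype.card {a // lvl a = i}) :=
    fun i hi => finrank_span_lowerRowBlock_le lvl D hD A E hA hE (by simpa using hi) hℓs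
  -- every generator lies in the sum of the row blocks
  have hdecomp : ∀ U' : Matrix ι ι K, (∀ a b, U' a b ≠ 0 → lvl b = lvl a + 1) →
      ∀ i, D (i + 1) * (P * U' * Q + Q * U' * P) * D i ∈ F1 i ⊔ F2 i := by
    intro U' hU' i
    have hU := levelled_eq_sum_proj_mul_mul_proj lvl D hD hlvl U' hU'
    rw [Matrix.mul_add, Matrix.add_mul]
    refine Submodule.add_mem_sup ?_ ?_
    · have : D (i + 1) * (P * U' * Q) * D i =
          ∑ j ∈ Finset.range d, (D (i + 1) * P * D j) * U' * (D (j + 1) * Q * D i) := by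
        conv_lhs => rw [hU]
        simp only [Finset.mul_sum, Finset.sum_mul]
        refine Finset.sum_congr rfl fun j _ => ?_
        simp only [Matrix.mul_assoc]
      rw [this]
      refine Submodule.sum_mem _ fun j hj => Submodule.subset_span ⟨⟨j, Finset.mem_range.mp hj⟩, U', rfl⟩
    · have : D (i + 1) * (Q * U' * P) * D i =
          ∑ j ∈ Finset.range d, (D (i + 1) * Q * D j) * U' * (D (j + 1) * P * D i) := by
        conv_lhs => rw [hU]
        simp only [Finset.mul_sum, Finset.sum_mul]
        refine Finset.sum_congr rfl fun j _ => ?_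
        simp only [Matrix.mul_assoc]
      rw [this]
      refine Submodule.sum_mem _ fun j hj => Submodule.subset_span ⟨⟨j, Finset.mem_range.mp hj⟩, U', rfl⟩
  have hle : Submodule.span K {Y : Matrix ι ι K | ∃ U' : Matrix ι ι K,
        (∀ a b, U' a b ≠ 0 → lvl b = lvl a + 1) ∧
        Y = ∑ i ∈ Finset.range d, D (i + 1) * (P * U' * Q + Q * U' * P) * D i} ≤
      (Finset.range d).sup fun i => F1 i ⊔ F2 i := by
    refine Submodule.span_le.mpr ?_
    rintro Y ⟨U', hU', rfl⟩
    refine Submodule.sum_mem _ fun i hi => ?_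
    exact (Finset.le_sup (f := fun i => F1 i ⊔ F2 i) hi) (hdecomp U' hU' i)
  calc Module.finrank K _ ≤ Module.finrank K ↥((Finset.range d).sup fun i => F1 i ⊔ F2 i) :=
        Submodule.finrank_mono hle
    _ ≤ ∑ i ∈ Finset.range d, Module.finrank K ↥(F1 i ⊔ F2 i) := finrank_finset_sup_le_sum _ _
    _ ≤ ∑ i ∈ Finset.range d, (Module.finrank K (F1 i) + Module.finrank K (F2 i)) := by
        refine Finset.sum_le_sum fun i _ => ?_
        have h := Submodule.finrank_sup_add_finrank_inf_eq (F1 i) (F2 i)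
        omega
    _ ≤ ∑ i ∈ Finset.range d, 2 * (Fintype.card {a // lvl a = ℓs} *
          (Fintype.card {a // lvl a = i + 1} + Fintype.card {a // lvl a = i})) := by
        refine Finset.sum_le_sum fun i hi => ?_
        have := hF1 i hi; have := hF2 i hi; omega
    _ = 2 * Fintype.card {a // lvl a = ℓs} *
        ∑ i ∈ Finset.range d, (Fintype.card {a // lvl a = i + 1} + Fintype.card {a // lvl a = i}) := by
        rw [Finset.mul_sum]; simp only [mul_assoc]

/-- **Corollary: `≤ 4·t·#ι`** (`t = #{lvl = ℓ⋆}` for ANY level `ℓ⋆ ≤ d`; with the thinnest level,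
`t·(d+1) ≤ #ι`, this is `4·#ι²/(d+1)`). [folklore] -/
theorem finrank_span_layeredHessianImage_le' (lvl : ι → ℕ) (D : ℕ → Matrix ι ι K)
    (hD : ∀ ℓ, D ℓ = Matrix.diagonal fun a => if lvl a = ℓ then (1 : K) else 0)
    {d : ℕ} (hlvl : ∀ a, lvl a ≤ d) (A E : Matrix ι ι K)
    (hA : ∀ a b, A a b ≠ 0 → lvl b = lvl a + 1) (hE : ∀ a b, E a b ≠ 0 → lvl a = d ∧ lvl b = 0)
    {ℓs : ℕ} (hℓs : ℓs ≤ d) :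
    Module.finrank K (Submodule.span K {Y : Matrix ι ι K | ∃ U' : Matrix ι ι K,
        (∀ a b, U' a b ≠ 0 → lvl b = lvl a + 1) ∧
        Y = ∑ i ∈ Finset.range d, D (i + 1) *
              ((∑ k ∈ Finset.range (d + 1), A ^ k) * U' *
                  ((∑ k ∈ Finset.range (d + 1), A ^ k) * E * (∑ k ∈ Finset.range (d + 1), A ^ k)) +
               ((∑ k ∈ Finset.range (d + 1), A ^ k) * E * (∑ k ∈ Finset.range (d + 1), A ^ k)) * U' *
                  (∑ k ∈ Finset.range (d + 1), A ^ k)) * D i}) ≤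
      4 * Fintype.card {a // lvl a = ℓs} * Fintype.card ι := by
  have h := finrank_span_layeredHessianImage_le lvl D hD hlvl A E hA hE hℓs
  have h2 := sum_card_level_pairs_le lvl d
  calc _ ≤ _ := h
    _ ≤ 2 * Fintype.card {a // lvl a = ℓs} * (2 * Fintype.card ι) := Nat.mul_le_mul_left _ h2
    _ = 4 * Fintype.card {a // lvl a = ℓs} * Fintype.card ι := by ring

end Summit.ValiantsHypothesis.ValiantsHypothesis.Cruxes.TwoDimCoefficients.DimTwoCases

end
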